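import Summits.QuantumFields.Balaban3D.Proofs.Bound55Std
import Summits.QuantumFields.Balaban3D.Proofs.TransportAC
import Summits.QuantumFields.Balaban3D.Proofs.StandardAC

/-!
# `Summit.QuantumFields.Balaban3D.Proofs.Bound55AC` — the step leaves C1 `Bound55` / C2 `Bound55Lower` of [Balaban1985UV3] ((22) p. 261, (55)·(58)
# pp. 269–270; p. 265 L21–28 / p. 272 L32–33) ON THE AC TOWER: seat p4's `Bound55Tower`/`Bound55Std` re-derived for an averaging that is merely
# ABSOLUTELY CONTINUOUS (`Carriers.AvgAC`) and the UNCAPPED masses of `…Proofs.MassesAC` — lane `pub-balaban3d`, seat alpha-1 (definition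
# request `defn-AlphaInputsT3AC` of route `UnitScaleTilt`, cell ym3-torus)

WHAT CHANGES AGAINST SEATS p4/p1 (finding F-α1-1): (i) the transport step (48)–(49) is `TransportAC.transport41_le_sum_ae_of_ac` (no `hmap`);
(ii) `hm₁` is `MassesAC.transport_le_massRecAC_ae` — NO hypothesis on the averaging (the masses ARE the transports; the lane needed `T1 = 1`);
(iii) `lower57 ≤ upper55` pointwise from `m(triv) ≥ 1` (the floor of `massRecAC`) instead of `m(triv) = 1`; (iv) `hint` from the INTEGRABILITY
of the masses (`TransportAC.integrable_mul_exp_of_le`) instead of `m ≤ 1`.  Everything else — the version selection (seat p1's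
`run3_rho_succ_le_upper`/`run3_lower_le_rho_succ`, which ask only `AvgAC`), the barrier pinning by `rfl` (`SeriesAC.withSeriesAC_upper/_lower`),
the decomposition-of-unity covering (seat p4's `stepWeight_mul_chiB_cover`) — is reused BY NAME.  The (β) content stays the two RESIDUAL
hypotheses, restated over the AC tower: `Fibre49AC` («The integral (49)» ≤ (55)·(58), per new history, transported form) and `Fibre57LowAC`
(the lower step bound at the trivial history).  HONEST FRAMING (lane PLAN.md §0): bookkeeping; nothing of CMP 102's saddle-point analysis is
proved here.
-/

noncomputable section

namespace Summit.QuantumFields.Balaban3D.Proofs.Bound55AC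

open _root_.MeasureTheory
open Literature.MathematicalPhysics.QuantumFieldTheory.Balaban1983to89
open Literature.MathematicalPhysics.QuantumFieldTheory.Balaban1983to89.AveragingRT (rnTransport)
open Literature.MathematicalPhysics.QuantumFieldTheory.Balaban1983to89.B10SectAGathering (StepPieces Bound55 Bound55Lower)
open Literature.MathematicalPhysics.QuantumFieldTheory.Balaban1985CMP102
open Literature.MathematicalPhysics.QuantumFieldTheory.Balaban1985CMP102.Setting
open Summit.QuantumFields.Balaban3D.Carriers
open Summit.QuantumFields.Balaban3D.Proofs.Transport48 (rnTransport_mono_ae)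
open Summit.QuantumFields.Balaban3D.Proofs.TransportAC
open Summit.QuantumFields.Balaban3D.Proofs.Bound55Masses (chiB chiB_nonneg chiB_le_one measurable_chiB measurable_stepWeight)
open Summit.QuantumFields.Balaban3D.Proofs.MassesAC
open Summit.QuantumFields.Balaban3D.Proofs.TowerAC
open Summit.QuantumFields.Balaban3D.Proofs.SeriesAC
open Summit.QuantumFields.Balaban3D.Proofs.StandardAC

variable {L : ℕ} {S : Scales L} {G : Type} [GaugeGroup G] [MeasurableSpace G] [HaarData G] [RegularGaugeGroup G]

/-! ## §1 The generic step on an AC tower input (seat p4's `Bound55Tower`, `AvgAC` form) -/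

section Tower

variable (D : TowerInputAC S G) (slot : ℕ → Prop) (k : ℕ)

/-- **(48)–(49) ⇒ the (55)·(58) bound, dV-a.e., on an AC tower** (seat p4's `Bound55Tower.transport_rho_le_lf_ae` with `AvgAC (D.av k).avg` in place
of measurability + Haar compatibility; masses `D.W` uncapped).  Given (41)_k, the covering `hcover`, the mass domination `hm₁`, integrable
(41)_k summands, and per new history THE FIBRE INEQUALITY `hfibre` ((β), not proved here): `T_k ρ_k ≤ LF_{k+1}(·)[(55)+(58) exponent]` dV-a.e.
[cite: Balaban1985UV3, (48)–(49) pp.267–268 + (55) p.269 + (58) p.270] -/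
theorem transport_rho_le_lf_ae (P : StepPieces (D.towerWith slot).toTowerRun k)
    (hac : AvgAC (D.av k).avg)
    (w χB : Hist S.P (k + 1) → Density S.P k G)
    (hw : ∀ h', Measurable (w h')) (hw0 : ∀ h' U, 0 ≤ w h' U) (hw1 : ∀ h' U, w h' U ≤ 1)
    (hχ : ∀ h', Measurable (χB h')) (hχ0 : ∀ h' U, 0 ≤ χB h' U) (hχ1 : ∀ h' U, χB h' U ≤ 1)
    (hcover : ∀ (h : Hist S.P k) (U : GaugeField S.P k G), D.W.mass k h U ≠ 0 →
      ∃ h' : Hist S.P (k + 1), h'.proj = h ∧ (1 : ℝ) ≤ w h' U * χB h' U)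
    (hm₁ : ∀ h' : Hist S.P (k + 1), (rnTransport (D.av k).avg fun U => w h' U * D.W.mass k h'.proj U)
      ≤ᵐ[fieldMeasure S.P (k + 1) G] D.W.mass (k + 1) h')
    (hint : ∀ h : Hist S.P k, Integrable (fun U => D.W.mass k h U *
      Real.exp (-((D.towerWith slot).mainT k h U) + D.Pint k h U - (D.towerWith slot).Ecst k
        + (D.towerWith slot).Zterm k h + (D.towerWith slot).Rm k)) (fieldMeasure S.P k G))
    (hfibre : ∀ h' : Hist S.P (k + 1),
      (rnTransport (D.av k).avg (fun U => w h' U * χB h' U * (D.W.mass k h'.proj U *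
        Real.exp (-((D.towerWith slot).mainT k h'.proj U) + D.Pint k h'.proj U - (D.towerWith slot).Ecst k
          + (D.towerWith slot).Zterm k h'.proj + (D.towerWith slot).Rm k))))
      ≤ᵐ[fieldMeasure S.P (k + 1) G] fun V => rnTransport (D.av k).avg (fun U => w h' U * D.W.mass k h'.proj U) V *
        Real.exp (-((D.towerWith slot).mainT (k + 1) h' V) - (D.towerWith slot).Ecst k
          + (P.logσ₀ + P.dg * Real.log (S.gk k)) * P.starB h' + P.logZU h' V + P.Pold h' V
          + (D.towerWith slot).Zterm k (P.proj h') + (D.towerWith slot).Rm k + P.logFl h' V))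
    (h41 : B10.Ineq41 (D.towerWith slot).toTowerRun k) :
    ∀ᵐ V ∂(fieldMeasure S.P (k + 1) G), rnTransport (D.av k).avg ((D.towerWith slot).rho k) V ≤
      (D.towerWith slot).LF (k + 1) V (fun h' => -((D.towerWith slot).mainT (k + 1) h' V) - (D.towerWith slot).Ecst k
          + (P.logσ₀ + P.dg * Real.log (S.gk k)) * P.starB h' + P.logZU h' V + P.Pold h' V
          + (D.towerWith slot).Zterm k (P.proj h') + (D.towerWith slot).Rm k + P.logFl h' V) := by
  have h41' : ∀ U : GaugeField S.P k G, (D.towerWith slot).rho k U ≤ ∑ h : Hist S.P k, D.W.mass k h U *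
      Real.exp (-((D.towerWith slot).mainT k h U) + D.Pint k h U - (D.towerWith slot).Ecst k
        + (D.towerWith slot).Zterm k h + (D.towerWith slot).Rm k) := fun U => h41 U
  have hρ : Integrable ((D.towerWith slot).rho k) (fieldMeasure S.P k G) := run3_rho_integrable (D.toRunInput slot) k
  exact transport41_le_sum_ae_of_ac hac (Hist.proj (P := S.P) (k := k)) ((D.towerWith slot).rho k) hρ
    (D.W.mass k) (fun h U => -((D.towerWith slot).mainT k h U) + D.Pint k h U - (D.towerWith slot).Ecst k
        + (D.towerWith slot).Zterm k h + (D.towerWith slot).Rm k)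
    w χB (D.W.mass (k + 1))
    (fun h' V => Real.exp (-((D.towerWith slot).mainT (k + 1) h' V) - (D.towerWith slot).Ecst k
          + (P.logσ₀ + P.dg * Real.log (S.gk k)) * P.starB h' + P.logZU h' V + P.Pold h' V
          + (D.towerWith slot).Zterm k (P.proj h') + (D.towerWith slot).Rm k + P.logFl h' V))
    h41' hint (D.W.mass_nonneg k) hw hw0 hw1 hχ hχ0 hχ1 hcover hm₁ (fun _ _ => (Real.exp_pos _).le) hfibre

/-- **`Bound55` BY NAME on an AC tower, from the a.e. bound by version selection** (seat p4's `bound55_of_select`, `AvgAC` form). [cite: Balaban1985UV3, (22) p.261 + (55) p.269 + (58) p.270] -/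
theorem bound55_of_select (P : StepPieces (D.towerWith slot).toTowerRun k)
    (hac : AvgAC (D.av k).avg)
    (w χB : Hist S.P (k + 1) → Density S.P k G)
    (hw : ∀ h', Measurable (w h')) (hw0 : ∀ h' U, 0 ≤ w h' U) (hw1 : ∀ h' U, w h' U ≤ 1)
    (hχ : ∀ h', Measurable (χB h')) (hχ0 : ∀ h' U, 0 ≤ χB h' U) (hχ1 : ∀ h' U, χB h' U ≤ 1)
    (hcover : ∀ (h : Hist S.P k) (U : GaugeField S.P k G), D.W.mass k h U ≠ 0 →
      ∃ h' : Hist S.P (k + 1), h'.proj = h ∧ (1 : ℝ) ≤ w h' U * χB h' U)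
    (hm₁ : ∀ h' : Hist S.P (k + 1), (rnTransport (D.av k).avg fun U => w h' U * D.W.mass k h'.proj U)
      ≤ᵐ[fieldMeasure S.P (k + 1) G] D.W.mass (k + 1) h')
    (hint : ∀ h : Hist S.P k, Integrable (fun U => D.W.mass k h U *
      Real.exp (-((D.towerWith slot).mainT k h U) + D.Pint k h U - (D.towerWith slot).Ecst k
        + (D.towerWith slot).Zterm k h + (D.towerWith slot).Rm k)) (fieldMeasure S.P k G))
    (hfibre : ∀ h' : Hist S.P (k + 1),
      (rnTransport (D.av k).avg (fun U => w h' U * χB h' U * (D.W.mass k h'.proj U *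
        Real.exp (-((D.towerWith slot).mainT k h'.proj U) + D.Pint k h'.proj U - (D.towerWith slot).Ecst k
          + (D.towerWith slot).Zterm k h'.proj + (D.towerWith slot).Rm k))))
      ≤ᵐ[fieldMeasure S.P (k + 1) G] fun V => rnTransport (D.av k).avg (fun U => w h' U * D.W.mass k h'.proj U) V *
        Real.exp (-((D.towerWith slot).mainT (k + 1) h' V) - (D.towerWith slot).Ecst k
          + (P.logσ₀ + P.dg * Real.log (S.gk k)) * P.starB h' + P.logZU h' V + P.Pold h' V
          + (D.towerWith slot).Zterm k (P.proj h') + (D.towerWith slot).Rm k + P.logFl h' V))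
    (hupper : ∀ V, D.upper k V =
      (D.towerWith slot).LF (k + 1) V (fun h' => -((D.towerWith slot).mainT (k + 1) h' V) - (D.towerWith slot).Ecst k
          + (P.logσ₀ + P.dg * Real.log (S.gk k)) * P.starB h' + P.logZU h' V + P.Pold h' V
          + (D.towerWith slot).Zterm k (P.proj h') + (D.towerWith slot).Rm k + P.logFl h' V))
    (hsel : (∀ᵐ V ∂(fieldMeasure S.P (k + 1) G), rnTransport (D.av k).avg ((D.towerWith slot).rho k) V ≤ D.upper k V) →
      ∀ V, (D.towerWith slot).rho (k + 1) V ≤ D.upper k V) :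
    Bound55 P := by
  intro h41 V
  have hae := transport_rho_le_lf_ae D slot k P hac w χB hw hw0 hw1 hχ hχ0 hχ1 hcover hm₁ hint hfibre h41
  have hae' : ∀ᵐ V ∂(fieldMeasure S.P (k + 1) G),
      rnTransport (D.av k).avg ((D.towerWith slot).rho k) V ≤ D.upper k V := by
    filter_upwards [hae] with V hV
    rw [hupper V]
    exact hV
  calc (D.towerWith slot).toTowerRun.ρ (k + 1) V = (D.towerWith slot).rho (k + 1) V := rfl
    _ ≤ D.upper k V := hsel hae' V
    _ = _ := hupper V

/-- **The LOWER step bound, dV-a.e., on an AC tower** (seat p4's `transport_lower_ae`, `AvgAC` form): from (47)_k, integrability of its left-hand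
side and the trivial-history fibre inequality `hfibreLow` ((β), not proved here), the left-hand side of `Bound55Lower P` is `≤ T_k ρ_k` dV-a.e.
[cite: Balaban1985UV3, p.265 L21–28 + (47) p.267 + p.272 L32–33] -/
theorem transport_lower_ae (P : StepPieces (D.towerWith slot).toTowerRun k) (hac : AvgAC (D.av k).avg)
    (hint47 : Integrable (fun U => (D.towerWith slot).chi k U *
      Real.exp (-((D.towerWith slot).mainT k (Hist.triv S.P k) U) + D.Pint k (Hist.triv S.P k) U
        - (D.towerWith slot).Ecst k - (D.towerWith slot).Rm k)) (fieldMeasure S.P k G))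
    (hfibreLow : (fun V => (D.towerWith slot).chi (k + 1) V *
        Real.exp (-((D.towerWith slot).mainT (k + 1) (Hist.triv S.P (k + 1)) V) - (D.towerWith slot).Ecst k
          + (P.logσ₀ + P.dg * Real.log (S.gk k)) * P.starB (Hist.triv S.P (k + 1)) + P.logZU (Hist.triv S.P (k + 1)) V
          + P.Pold (Hist.triv S.P (k + 1)) V - (D.towerWith slot).Rm k + P.logFl (Hist.triv S.P (k + 1)) V))
      ≤ᵐ[fieldMeasure S.P (k + 1) G] rnTransport (D.av k).avg (fun U => (D.towerWith slot).chi k U *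
        Real.exp (-((D.towerWith slot).mainT k (Hist.triv S.P k) U) + D.Pint k (Hist.triv S.P k) U
          - (D.towerWith slot).Ecst k - (D.towerWith slot).Rm k)))
    (h47 : B10.Ineq47 (D.towerWith slot).toTowerRun k) :
    ∀ᵐ V ∂(fieldMeasure S.P (k + 1) G), (D.towerWith slot).chi (k + 1) V *
        Real.exp (-((D.towerWith slot).mainT (k + 1) (Hist.triv S.P (k + 1)) V) - (D.towerWith slot).Ecst k
          + (P.logσ₀ + P.dg * Real.log (S.gk k)) * P.starB (Hist.triv S.P (k + 1)) + P.logZU (Hist.triv S.P (k + 1)) V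
          + P.Pold (Hist.triv S.P (k + 1)) V - (D.towerWith slot).Rm k + P.logFl (Hist.triv S.P (k + 1)) V)
      ≤ rnTransport (D.av k).avg ((D.towerWith slot).rho k) V := by
  have h47' : ∀ U : GaugeField S.P k G, (D.towerWith slot).chi k U *
      Real.exp (-((D.towerWith slot).mainT k (Hist.triv S.P k) U) + D.Pint k (Hist.triv S.P k) U
        - (D.towerWith slot).Ecst k - (D.towerWith slot).Rm k) ≤ (D.towerWith slot).rho k U := fun U => h47 U
  have hρ : Integrable ((D.towerWith slot).rho k) (fieldMeasure S.P k G) := run3_rho_integrable (D.toRunInput slot) k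
  have hmono := rnTransport_mono_ae hac h47' hint47 hρ
  filter_upwards [hfibreLow, hmono] with V h1 h2
  exact h1.trans h2

/-- **`Bound55Lower` BY NAME on an AC tower, from the a.e. bound by version selection** (seat p4's `bound55Lower_of_select`, `AvgAC` form). [cite: Balaban1985UV3, p.265 L21–28 + (47) p.267 + p.272 L32–33] -/
theorem bound55Lower_of_select (P : StepPieces (D.towerWith slot).toTowerRun k) (hac : AvgAC (D.av k).avg)
    (hint47 : Integrable (fun U => (D.towerWith slot).chi k U *
      Real.exp (-((D.towerWith slot).mainT k (Hist.triv S.P k) U) + D.Pint k (Hist.triv S.P k) U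
        - (D.towerWith slot).Ecst k - (D.towerWith slot).Rm k)) (fieldMeasure S.P k G))
    (hfibreLow : (fun V => (D.towerWith slot).chi (k + 1) V *
        Real.exp (-((D.towerWith slot).mainT (k + 1) (Hist.triv S.P (k + 1)) V) - (D.towerWith slot).Ecst k
          + (P.logσ₀ + P.dg * Real.log (S.gk k)) * P.starB (Hist.triv S.P (k + 1)) + P.logZU (Hist.triv S.P (k + 1)) V
          + P.Pold (Hist.triv S.P (k + 1)) V - (D.towerWith slot).Rm k + P.logFl (Hist.triv S.P (k + 1)) V))
      ≤ᵐ[fieldMeasure S.P (k + 1) G] rnTransport (D.av k).avg (fun U => (D.towerWith slot).chi k U *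
        Real.exp (-((D.towerWith slot).mainT k (Hist.triv S.P k) U) + D.Pint k (Hist.triv S.P k) U
          - (D.towerWith slot).Ecst k - (D.towerWith slot).Rm k)))
    (hlower : ∀ V, D.lower k V = (D.towerWith slot).chi (k + 1) V *
        Real.exp (-((D.towerWith slot).mainT (k + 1) (Hist.triv S.P (k + 1)) V) - (D.towerWith slot).Ecst k
          + (P.logσ₀ + P.dg * Real.log (S.gk k)) * P.starB (Hist.triv S.P (k + 1)) + P.logZU (Hist.triv S.P (k + 1)) V
          + P.Pold (Hist.triv S.P (k + 1)) V - (D.towerWith slot).Rm k + P.logFl (Hist.triv S.P (k + 1)) V))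
    (hsel : (∀ᵐ V ∂(fieldMeasure S.P (k + 1) G), D.lower k V ≤ rnTransport (D.av k).avg ((D.towerWith slot).rho k) V) →
      ∀ V, D.lower k V ≤ (D.towerWith slot).rho (k + 1) V) :
    Bound55Lower P := by
  intro h47 V
  have hae := transport_lower_ae D slot k P hac hint47 hfibreLow h47
  have hae' : ∀ᵐ V ∂(fieldMeasure S.P (k + 1) G),
      D.lower k V ≤ rnTransport (D.av k).avg ((D.towerWith slot).rho k) V := by
    filter_upwards [hae] with V hV
    rw [hlower V]
    exact hV
  calc _ = D.lower k V := (hlower V).symm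
    _ ≤ (D.towerWith slot).rho (k + 1) V := hsel hae' V
    _ = (D.towerWith slot).toTowerRun.ρ (k + 1) V := rfl

omit [RegularGaugeGroup G] in
/-- **`lower57 ≤ upper55` POINTWISE on an AC tower FROM `m(triv) ≥ 1`** (seat p4's `lower57_le_upper55` asked `m(triv) = 1`; the uncapped masses
are floored at `1` at the trivial history, `MassesAC.one_le_massRecAC_triv`): the exponents differ by `Zterm_k(triv) + 2·Rm_k = 2·Rm_k ≥ 0` and
`χ_{k+1} ≤ 1 ≤ m_{k+1}(triv)`. [cite: Balaban1985UV3, (47) p.267 + p.272 L32–33] -/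
theorem lower57_le_upper55_of_one_le (P : StepPieces (D.towerWith slot).toTowerRun k)
    (hmt : ∀ V : GaugeField S.P (k + 1) G, 1 ≤ D.W.mass (k + 1) (Hist.triv S.P (k + 1)) V)
    (hRm : 0 ≤ (D.towerWith slot).Rm k) (V : GaugeField S.P (k + 1) G) :
    (D.towerWith slot).chi (k + 1) V *
        Real.exp (-((D.towerWith slot).mainT (k + 1) (Hist.triv S.P (k + 1)) V) - (D.towerWith slot).Ecst k
          + (P.logσ₀ + P.dg * Real.log (S.gk k)) * P.starB (Hist.triv S.P (k + 1)) + P.logZU (Hist.triv S.P (k + 1)) V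
          + P.Pold (Hist.triv S.P (k + 1)) V - (D.towerWith slot).Rm k + P.logFl (Hist.triv S.P (k + 1)) V)
      ≤ (D.towerWith slot).LF (k + 1) V (fun h' => -((D.towerWith slot).mainT (k + 1) h' V) - (D.towerWith slot).Ecst k
          + (P.logσ₀ + P.dg * Real.log (S.gk k)) * P.starB h' + P.logZU h' V + P.Pold h' V
          + (D.towerWith slot).Zterm k (P.proj h') + (D.towerWith slot).Rm k + P.logFl h' V) := by
  have hχ1 : (D.towerWith slot).chi (k + 1) V ≤ 1 := by
    show chiSmall Set.univ ((D.toRunInput slot).ε₁ (k + 1)) V ≤ 1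
    unfold chiSmall; split_ifs <;> norm_num
  have hproj : P.proj (Hist.triv S.P (k + 1)) = Hist.triv S.P k := P.proj_triv
  have hZ : (D.towerWith slot).Zterm k (Hist.triv S.P k) = 0 := (D.towerWith slot).toTowerRun.Zterm_triv k
  refine le_trans ?_ (mass_mul_exp_le_lfAC D.W (k + 1) (Hist.triv S.P (k + 1)) V _)
  refine mul_le_mul (hχ1.trans (hmt V)) (Real.exp_le_exp.mpr ?_) (Real.exp_pos _).le (zero_le_one.trans (hmt V))
  rw [hproj, hZ]
  linarith

end Tower

/-! ## §2 The two (β) RESIDUALS restated over the standard AC tower -/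

section Std

variable {V : Type} [NormedAddCommGroup V] [NormedSpace ℂ V]
  (X : ExternalInputsAC S G) (K : CarrierConsts) (𝔖 : ∀ k, StepSeries S G V (nblkOf S K k) k) (slot : ℕ → Prop) (k : ℕ)

/-- **RESIDUAL R3D-01 `Fibre49` ON THE AC TOWER** — «The integral (49)» ≤ (51) ≤ (55)·(58) ([Balaban1985UV3] pp. 268–270; (12)→(22) pp. 259–261 at
k = 0), in TRANSPORTED form at the standard AC tower, for the new history `h′` of step `k`: seat p4's `Bound55Std.Fibre49` with the averaging
`X.av` merely absolutely continuous and the masses the exact transports `massRecAC` (so the local Jacobians of `Ū_k` ride inside BOTH sides).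
A (β) ρ-display ASSUMED, not proved (status RESIDUAL). [cite: Balaban1985UV3, (49)–(58) pp.268–270 + (12)–(22) pp.259–261] -/
def Fibre49AC (P : StepPieces ((stdTowerInputAC X K 𝔖).towerWith slot).toTowerRun k) (h' : Hist S.P (k + 1)) : Prop :=
  (rnTransport (X.av k).avg (fun U =>
    stepWeight K.M₁ (rcolOf S K) (eps1Of S K) (epsSOf S K) k h' U * chiB K.M₁ (rcolOf S K) (eps1Of S K) k h' U *
      ((stdTowerInputAC X K 𝔖).W.mass k h'.proj U *
        Real.exp (-(((stdTowerInputAC X K 𝔖).towerWith slot).mainT k h'.proj U) + (stdTowerInputAC X K 𝔖).Pint k h'.proj U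
          - ((stdTowerInputAC X K 𝔖).towerWith slot).Ecst k
          + ((stdTowerInputAC X K 𝔖).towerWith slot).Zterm k h'.proj + ((stdTowerInputAC X K 𝔖).towerWith slot).Rm k))))
  ≤ᵐ[fieldMeasure S.P (k + 1) G] fun V =>
    rnTransport (X.av k).avg (fun U =>
      stepWeight K.M₁ (rcolOf S K) (eps1Of S K) (epsSOf S K) k h' U * (stdTowerInputAC X K 𝔖).W.mass k h'.proj U) V *
    Real.exp (-(((stdTowerInputAC X K 𝔖).towerWith slot).mainT (k + 1) h' V) - ((stdTowerInputAC X K 𝔖).towerWith slot).Ecst k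
      + (P.logσ₀ + P.dg * Real.log (S.gk k)) * P.starB h' + P.logZU h' V + P.Pold h' V
      + ((stdTowerInputAC X K 𝔖).towerWith slot).Zterm k (P.proj h') + ((stdTowerInputAC X K 𝔖).towerWith slot).Rm k
      + P.logFl h' V)

/-- **RESIDUAL R3D-02 `Fibre57Low` ON THE AC TOWER** — the LOWER step bound at the trivial history («the χ_(4)-variant of (57)», seat p4's
`Bound55Std.Fibre57Low`, lead ruling R-CHI), in TRANSPORTED form at the standard AC tower: `χ_{k+1}·exp[(57) exponent at triv] ≤
T_k[χ_k·exp((47)_k exponent at triv)]` dV-a.e.  A (β) ρ-display ASSUMED, not proved (status RESIDUAL). [cite: Balaban1985UV3, p.265 L21–28 + (47) p.267 + p.272 L32–33] -/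
def Fibre57LowAC (P : StepPieces ((stdTowerInputAC X K 𝔖).towerWith slot).toTowerRun k) : Prop :=
  (fun V => ((stdTowerInputAC X K 𝔖).towerWith slot).chi (k + 1) V *
      Real.exp (-(((stdTowerInputAC X K 𝔖).towerWith slot).mainT (k + 1) (Hist.triv S.P (k + 1)) V)
        - ((stdTowerInputAC X K 𝔖).towerWith slot).Ecst k
        + (P.logσ₀ + P.dg * Real.log (S.gk k)) * P.starB (Hist.triv S.P (k + 1)) + P.logZU (Hist.triv S.P (k + 1)) V
        + P.Pold (Hist.triv S.P (k + 1)) V - ((stdTowerInputAC X K 𝔖).towerWith slot).Rm k + P.logFl (Hist.triv S.P (k + 1)) V))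
    ≤ᵐ[fieldMeasure S.P (k + 1) G] rnTransport (X.av k).avg (fun U => ((stdTowerInputAC X K 𝔖).towerWith slot).chi k U *
      Real.exp (-(((stdTowerInputAC X K 𝔖).towerWith slot).mainT k (Hist.triv S.P k) U) + (stdTowerInputAC X K 𝔖).Pint k (Hist.triv S.P k) U
        - ((stdTowerInputAC X K 𝔖).towerWith slot).Ecst k - ((stdTowerInputAC X K 𝔖).towerWith slot).Rm k))

/-! ## §3 C1/C2 at the standard AC tower: everything but the residuals discharged -/

omit [RegularGaugeGroup G] in
/-- **`lower_k ≤ upper_k` POINTWISE at the standard AC tower** (the `hlu` of seat p1's `run3_rho_succ_le_upper`): barrier pinnings (`rfl` for the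
series' pieces) and `Rm_k ≥ 0`; the trivial-history mass is `≥ 1` (`one_le_stdTowerInputAC_mass_triv`). [cite: Balaban1985UV3, (47) p.267 + p.272 L32–33] -/
theorem lower_le_upper_stdAC (P : StepPieces ((stdTowerInputAC X K 𝔖).towerWith slot).toTowerRun k)
    (hRm : 0 ≤ ((stdTowerInputAC X K 𝔖).towerWith slot).Rm k)
    (hupper : ∀ V, (stdTowerInputAC X K 𝔖).upper k V =
      ((stdTowerInputAC X K 𝔖).towerWith slot).LF (k + 1) V (fun h' =>
        -(((stdTowerInputAC X K 𝔖).towerWith slot).mainT (k + 1) h' V) - ((stdTowerInputAC X K 𝔖).towerWith slot).Ecst k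
          + (P.logσ₀ + P.dg * Real.log (S.gk k)) * P.starB h' + P.logZU h' V + P.Pold h' V
          + ((stdTowerInputAC X K 𝔖).towerWith slot).Zterm k (P.proj h') + ((stdTowerInputAC X K 𝔖).towerWith slot).Rm k
          + P.logFl h' V))
    (hlower : ∀ V, (stdTowerInputAC X K 𝔖).lower k V = ((stdTowerInputAC X K 𝔖).towerWith slot).chi (k + 1) V *
        Real.exp (-(((stdTowerInputAC X K 𝔖).towerWith slot).mainT (k + 1) (Hist.triv S.P (k + 1)) V)
          - ((stdTowerInputAC X K 𝔖).towerWith slot).Ecst k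
          + (P.logσ₀ + P.dg * Real.log (S.gk k)) * P.starB (Hist.triv S.P (k + 1)) + P.logZU (Hist.triv S.P (k + 1)) V
          + P.Pold (Hist.triv S.P (k + 1)) V - ((stdTowerInputAC X K 𝔖).towerWith slot).Rm k + P.logFl (Hist.triv S.P (k + 1)) V))
    (W : GaugeField S.P (k + 1) G) :
    (stdTowerInputAC X K 𝔖).lower k W ≤ (stdTowerInputAC X K 𝔖).upper k W := by
  rw [hlower W, hupper W]
  exact lower57_le_upper55_of_one_le (stdTowerInputAC X K 𝔖) slot k P (one_le_stdTowerInputAC_mass_triv X K 𝔖 (k + 1)) hRm W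

/-- **C1 AT THE STANDARD AC TOWER**: LQB's `Bound55 P` for any step pieces `P` over `(stdTowerInputAC X K 𝔖).towerWith slot`, from the threshold
ordering `εL ≤ εS` AT THIS STEP (`hLS`), the integrability of the (41)_k summands (`hint`), the barrier pinnings (`hupper`, `hlower`, `rfl` for the
series' pieces), `Rm_k ≥ 0`, and — THE (β) CONTENT — the residual `Fibre49AC` for every new history.  Discharged inside WITH NO HYPOTHESIS ON THE
AVERAGING beyond `AvgAC`: `hcover` (`MassesAC.massRecAC_cover`), `hm₁` (`MassesAC.transport_le_massRecAC_ae`). [cite: Balaban1985UV3, (48)–(49) pp.267–268 + (55) p.269 + (58) p.270] -/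
theorem bound55_stdAC (P : StepPieces ((stdTowerInputAC X K 𝔖).towerWith slot).toTowerRun k)
    (hLS : eps1Of S K k ≤ epsSOf S K k)
    (hint : ∀ h : Hist S.P k, Integrable (fun U => (stdTowerInputAC X K 𝔖).W.mass k h U *
      Real.exp (-(((stdTowerInputAC X K 𝔖).towerWith slot).mainT k h U) + (stdTowerInputAC X K 𝔖).Pint k h U
        - ((stdTowerInputAC X K 𝔖).towerWith slot).Ecst k
        + ((stdTowerInputAC X K 𝔖).towerWith slot).Zterm k h + ((stdTowerInputAC X K 𝔖).towerWith slot).Rm k)) (fieldMeasure S.P k G))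
    (hfibre : ∀ h' : Hist S.P (k + 1), Fibre49AC X K 𝔖 slot k P h')
    (hupper : ∀ V, (stdTowerInputAC X K 𝔖).upper k V =
      ((stdTowerInputAC X K 𝔖).towerWith slot).LF (k + 1) V (fun h' =>
        -(((stdTowerInputAC X K 𝔖).towerWith slot).mainT (k + 1) h' V) - ((stdTowerInputAC X K 𝔖).towerWith slot).Ecst k
          + (P.logσ₀ + P.dg * Real.log (S.gk k)) * P.starB h' + P.logZU h' V + P.Pold h' V
          + ((stdTowerInputAC X K 𝔖).towerWith slot).Zterm k (P.proj h') + ((stdTowerInputAC X K 𝔖).towerWith slot).Rm k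
          + P.logFl h' V))
    (hlower : ∀ V, (stdTowerInputAC X K 𝔖).lower k V = ((stdTowerInputAC X K 𝔖).towerWith slot).chi (k + 1) V *
        Real.exp (-(((stdTowerInputAC X K 𝔖).towerWith slot).mainT (k + 1) (Hist.triv S.P (k + 1)) V)
          - ((stdTowerInputAC X K 𝔖).towerWith slot).Ecst k
          + (P.logσ₀ + P.dg * Real.log (S.gk k)) * P.starB (Hist.triv S.P (k + 1)) + P.logZU (Hist.triv S.P (k + 1)) V
          + P.Pold (Hist.triv S.P (k + 1)) V - ((stdTowerInputAC X K 𝔖).towerWith slot).Rm k + P.logFl (Hist.triv S.P (k + 1)) V))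
    (hRm : 0 ≤ ((stdTowerInputAC X K 𝔖).towerWith slot).Rm k) :
    Bound55 P :=
  bound55_of_select (stdTowerInputAC X K 𝔖) slot k P (X.av_ac k)
    (stepWeight K.M₁ (rcolOf S K) (eps1Of S K) (epsSOf S K) k) (chiB K.M₁ (rcolOf S K) (eps1Of S K) k)
    (measurable_stepWeight K.M₁ (rcolOf S K) (eps1Of S K) (epsSOf S K) k)
    (stepWeight_nonneg K.M₁ (rcolOf S K) (eps1Of S K) (epsSOf S K) k)
    (stepWeight_le_one K.M₁ (rcolOf S K) (eps1Of S K) (epsSOf S K) k)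
    (measurable_chiB K.M₁ (rcolOf S K) (eps1Of S K) k)
    (chiB_nonneg K.M₁ (rcolOf S K) (eps1Of S K) k)
    (chiB_le_one K.M₁ (rcolOf S K) (eps1Of S K) k)
    (massRecAC_cover K.M₁ (rcolOf S K) (eps1Of S K) (epsSOf S K) X.av k hLS)
    (transport_le_massRecAC_ae K.M₁ (rcolOf S K) (eps1Of S K) (epsSOf S K) X.av k)
    hint hfibre hupper
    (fun hae W => run3_rho_succ_le_upper ((stdTowerInputAC X K 𝔖).toRunInput slot) k hae
      (lower_le_upper_stdAC X K 𝔖 slot k P hRm hupper hlower) W)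

/-- **C2 AT THE STANDARD AC TOWER**: LQB's `Bound55Lower P` from the integrability of the (47)_k left-hand side (`hint47`), the lower-barrier pinning
(`hlower`), seat p1's one-sided selection `run3_lower_le_rho_succ`, and — THE (β) CONTENT — the residual `Fibre57LowAC`.
[cite: Balaban1985UV3, p.265 L21–28 + (47) p.267 + p.272 L32–33] -/
theorem bound55Lower_stdAC (P : StepPieces ((stdTowerInputAC X K 𝔖).towerWith slot).toTowerRun k)
    (hint47 : Integrable (fun U => ((stdTowerInputAC X K 𝔖).towerWith slot).chi k U *
      Real.exp (-(((stdTowerInputAC X K 𝔖).towerWith slot).mainT k (Hist.triv S.P k) U)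
        + (stdTowerInputAC X K 𝔖).Pint k (Hist.triv S.P k) U
        - ((stdTowerInputAC X K 𝔖).towerWith slot).Ecst k - ((stdTowerInputAC X K 𝔖).towerWith slot).Rm k)) (fieldMeasure S.P k G))
    (hfibreLow : Fibre57LowAC X K 𝔖 slot k P)
    (hlower : ∀ V, (stdTowerInputAC X K 𝔖).lower k V = ((stdTowerInputAC X K 𝔖).towerWith slot).chi (k + 1) V *
        Real.exp (-(((stdTowerInputAC X K 𝔖).towerWith slot).mainT (k + 1) (Hist.triv S.P (k + 1)) V)
          - ((stdTowerInputAC X K 𝔖).towerWith slot).Ecst k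
          + (P.logσ₀ + P.dg * Real.log (S.gk k)) * P.starB (Hist.triv S.P (k + 1)) + P.logZU (Hist.triv S.P (k + 1)) V
          + P.Pold (Hist.triv S.P (k + 1)) V - ((stdTowerInputAC X K 𝔖).towerWith slot).Rm k + P.logFl (Hist.triv S.P (k + 1)) V))
    : Bound55Lower P :=
  bound55Lower_of_select (stdTowerInputAC X K 𝔖) slot k P (X.av_ac k) hint47 hfibreLow hlower
    (fun hae W => run3_lower_le_rho_succ ((stdTowerInputAC X K 𝔖).toRunInput slot) k hae W)

/-! ## §4 The integrability side conditions `hint`/`hint47` WITH UNBOUNDED MASSES -/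

/-- **`hint` DERIVED for the AC tower**: the (41)_k summand `m_k(h)·exp[−(1/g_k²)A^η(U_k(·,h)) + Σ𝒫 − E_k + Z-terms + remainders]` is integrable as
soon as the minimizer map `U_k(·, h)` is MEASURABLE and the interaction sum `Pint k h` is MEASURABLE and BOUNDED ABOVE — the masses being
INTEGRABLE (`StandardAC.stdTowerInputAC_mass_integrable`; seat p4's `hint_std` used `m ≤ 1`), `A^η ≥ 0` measurable (seat p4). [folklore] -/
theorem hint_stdAC (hU : ∀ h : Hist S.P k, Measurable ((stdTowerInputAC X K 𝔖).UkH k h))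
    (hPm : ∀ h : Hist S.P k, Measurable ((stdTowerInputAC X K 𝔖).Pint k h)) (cP : ℝ)
    (hPb : ∀ (h : Hist S.P k) (U : GaugeField S.P k G), (stdTowerInputAC X K 𝔖).Pint k h U ≤ cP) (h : Hist S.P k) :
    Integrable (fun U => (stdTowerInputAC X K 𝔖).W.mass k h U *
      Real.exp (-(((stdTowerInputAC X K 𝔖).towerWith slot).mainT k h U) + (stdTowerInputAC X K 𝔖).Pint k h U
        - ((stdTowerInputAC X K 𝔖).towerWith slot).Ecst k
        + ((stdTowerInputAC X K 𝔖).towerWith slot).Zterm k h + ((stdTowerInputAC X K 𝔖).towerWith slot).Rm k)) (fieldMeasure S.P k G) := by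
  have hmain : ∀ U, ((stdTowerInputAC X K 𝔖).towerWith slot).mainT k h U
      = (S.gk k)⁻¹ ^ 2 * S.actionEta k ((stdTowerInputAC X K 𝔖).UkH k h U) := fun _ => rfl
  refine integrable_mul_exp_of_le (stdTowerInputAC_mass_integrable X K 𝔖 k h) ?_
    (c := cP - ((stdTowerInputAC X K 𝔖).towerWith slot).Ecst k
      + ((stdTowerInputAC X K 𝔖).towerWith slot).Zterm k h + ((stdTowerInputAC X K 𝔖).towerWith slot).Rm k) ?_
  · simp_rw [hmain]
    exact ((((measurable_const.mul ((Bound55Std.measurable_actionEta (S := S) k).comp (hU h))).neg.add (hPm h)).sub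
      measurable_const).add measurable_const).add measurable_const
  · intro U
    have h0 : 0 ≤ ((stdTowerInputAC X K 𝔖).towerWith slot).mainT k h U := by
      rw [hmain]; exact mul_nonneg (sq_nonneg _) (Bound55Std.actionEta_nonneg (S := S) k _)
    have h1 := hPb h U
    linarith

/-- **`hint47` DERIVED for the AC tower** (the (47)_k left-hand side; `χ_k ∈ [0,1]` measurable, seat p4's `hint47_std` verbatim). [folklore] -/
theorem hint47_stdAC (hU : Measurable ((stdTowerInputAC X K 𝔖).UkH k (Hist.triv S.P k)))
    (hPm : Measurable ((stdTowerInputAC X K 𝔖).Pint k (Hist.triv S.P k))) (cP : ℝ)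
    (hPb : ∀ U : GaugeField S.P k G, (stdTowerInputAC X K 𝔖).Pint k (Hist.triv S.P k) U ≤ cP) :
    Integrable (fun U => ((stdTowerInputAC X K 𝔖).towerWith slot).chi k U *
      Real.exp (-(((stdTowerInputAC X K 𝔖).towerWith slot).mainT k (Hist.triv S.P k) U)
        + (stdTowerInputAC X K 𝔖).Pint k (Hist.triv S.P k) U
        - ((stdTowerInputAC X K 𝔖).towerWith slot).Ecst k - ((stdTowerInputAC X K 𝔖).towerWith slot).Rm k)) (fieldMeasure S.P k G) := by
  have hmain : ∀ U, ((stdTowerInputAC X K 𝔖).towerWith slot).mainT k (Hist.triv S.P k) U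
      = (S.gk k)⁻¹ ^ 2 * S.actionEta k ((stdTowerInputAC X K 𝔖).UkH k (Hist.triv S.P k) U) := fun _ => rfl
  have hchi : ((stdTowerInputAC X K 𝔖).towerWith slot).chi k = chiSmall Set.univ ((stdTowerInputAC X K 𝔖).ε₁ k) := rfl
  refine Transport48.integrable_weight_mul_exp ?_ ?_ ?_ ?_
    (c := cP - ((stdTowerInputAC X K 𝔖).towerWith slot).Ecst k - ((stdTowerInputAC X K 𝔖).towerWith slot).Rm k) ?_
  · rw [hchi]; exact T4AxialGaugeFixing.measurable_chiSmall _ _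
  · intro U; rw [hchi]; unfold chiSmall; split_ifs <;> norm_num
  · intro U; rw [hchi]; unfold chiSmall; split_ifs <;> norm_num
  · simp_rw [hmain]
    exact (((measurable_const.mul ((Bound55Std.measurable_actionEta (S := S) k).comp hU)).neg.add hPm).sub measurable_const).sub
      measurable_const
  · intro U
    have h0 : 0 ≤ ((stdTowerInputAC X K 𝔖).towerWith slot).mainT k (Hist.triv S.P k) U := by
      rw [hmain]; exact mul_nonneg (sq_nonneg _) (Bound55Std.actionEta_nonneg (S := S) k _)
    have h1 := hPb U
    linarith

end Std

end Summit.QuantumFields.Balaban3D.Proofs.Bound55AC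

end
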